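import Summits.Ventures.CertifiedManyBodySolver.Rows.CorrWindowCertKernelChain
import Summits.Ventures.CertifiedManyBodySolver.Downfold.BoxesLa214V115M2cPairRowCloser
import HarnessLib

/-!
# PINNED `t′`-PAIR nodes‴ (WN shapes) and the M2(c) leaf FROM TWO STAGED KERNEL REPLAYS (encoded merge CHAINS) sharing ONE eom word list — the chain-level
# corollaries of FILE E (`Downfold/PinnedPairTPrimeOfResidPolys.lean`, `Downfold/BoxesLa214V115M2cPairRowCloser.lean`)

Venture CertifiedManyBodySolver; cell `hubbard-obs` / D-0154 (1)(C) COVERAGE; seat `hubbard-cov-la214-box-2` (g3); captain hubbard-cov-la214-plan-1 g3 GO (5),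
hubbard-obs STATUS 2026-08-28T22:08:48Z («your third ≤ 80-l. chain-corollary file ONLY AFTER (v′) lands» — (v′) = hubbard-obs-p2 g23's
`Rows/CorrWindowCertKernelChain.lean`, p672734, LANDED 22:15Z). Nothing of hubbard-obs-p2's is restated: per vertex the chain facts give the SEMANTIC residual
hypothesis `hR_v` of FILE E by `evalPoly_chain_nil` + `flatten_groupSlices` + `flatten_residTGslices` (+ `flatten_gramTBslices` for the two-level Gram), exactly
as in `CARPolyWindow.affineOrbitLowerRowN_of_chainKernelCert{G,TB}`.

* `TPrimePinnedPairFamilyRowWN.of_chainKernelCerts_tb` / `TPrimePinnedPairRowWN.of_chainKernelCerts_tb` — letters `Orb (Fin N)` (hubbard-obs-p2's chain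
  alphabet), per vertex the data of `affineOrbitLowerRowN_of_chainKernelCertTB` MINUS the filling bounds (WN = every filling) — i.e. two-level Gram `blocks_v`,
  slice groups `ns_v`, step count `M_v`, accumulators `Cs_v` with `Cs_v.getD 0 [] = []`, `ChainOK Bkey M_v Cs_v (groupSlices (residTGslices … (gramTBslices K_v
  blocks_v) …) ns_v)`, ONE inequality `β_v ≤ lowerConst (decPoly N (Cs_v.getD M_v [])) + (μ_v 0 + μ_v 1)(n₀/2 − ν_v)` — PLUS the slope `sl_v = (μ_v 0 + μ_v 1)/2`,
  with ONE shared `EB` ⟹ the WN pair node‴ (family / constant word).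
* `La214M2c_StiffnessBoxCeiling_of_chainKernelPairs` — four chains (the `Po` pair at `t′ = −357/740 ∣ −3/10` with the corner word and ONE `EBo`; the `Oi` pair at
  `−3/10 ∣ −1/5` with own words and ONE `EBi`) + FILE D's decidable row data ⟹ `La214M2c_StiffnessBoxCeiling`, via `La214M2c_StiffnessBoxCeiling_of_pairRows`.

EFFECT: the exporter's ACTUAL output format for a tree-feasible tier-P instance (per-step `decide +kernel` facts on packed accumulator literals, hubbard-obs STATUS
2026-08-28T22:15:24Z / 22:16:44Z) reaches the M2(c) leaf and every WN pair node‴ with no further Lean between them. Instantiated here by NO certificate (no chain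
of record exists; the M2(c) certificates of record are EXT5-L⁺-class, outside the measured `decide` reach — this is interface typing, not a forecast).
HONEST FRAMING: Lean plumbing; evaluates nothing, discharges NO node; no number of record / tier / hold / box word / registry row changes (M2(c) edition of record
`…_cQ` p660755 ⇐ the pair nodes‴ p663521 / p665068, box word 0.4001659, margin 0.0015674); CONTROL / CALIBRATION class (wording (xx1)); a ceiling never speaks to the
presence of superconductivity or to `ρ_s = 0`; no `T_c` / phase sentence; nothing about La₁.₈₇₅Sr₀.₁₂₅CuO₄ samples; no item, rung leaf or summit statement is proved
here. Zero compute.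

References: J. Wang et al., PRX 14 (2024) 031006, §III [cite: WangEtAl2024, §III]; C. Jansson, D. Chaykin, C. Keil, SIAM J. Numer. Anal. 46 (2008) 180, §3
[cite: JanssonChaykinKeil2008, §3]; X. Han, arXiv:2006.06002, §2 [cite: Han2020Bootstrap, §2]; T. Koma, H. Tasaki, J. Stat. Phys. 76 (1994) 745, §1
[cite: KomaTasaki1994, §1].
-/

noncomputable section

namespace Summit.Ventures.CertifiedManyBodySolver.Downfold

open Literature.MathematicalPhysics.QuantumLattice
open Matrix HubbardWave0 Literature.Probability.LatticeModels ThermodynamicLimit Filter Topology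
open Literature.MathematicalPhysics.QuantumManyBody.StateRelaxation
open Summit.Ventures.CertifiedQuantumChemistry Summit.Ventures.CertifiedQuantumChemistry.CARPoly
open Summit.Ventures.CertifiedManyBodySolver.CARPolyWindow
open Summit.Ventures.CertifiedManyBodySolver.Observables
open scoped BigOperators ComplexOrder

/-! ## §1 WN pair nodes‴ from two chains (two-level Gram slices) -/

section ChainPair

variable {β : Type*} {N : ℕ} [NeZero N]

/-- **WN-FAMILY PAIR NODE‴ FROM TWO STAGED KERNEL REPLAYS** (encoded merge chains over the regrouped sliced residuals, two-level Gram slices, empty start,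
ONE shared `EB`): per vertex `ChainOK …` + `β_v ≤ lowerConst (decPoly N C_{M_v}) + (μ_v 0 + μ_v 1)(n₀/2 − ν_v)` + `sl_v = (μ_v 0 + μ_v 1)/2` ⟹ the family pair row.
[cite: WangEtAl2024, §III] [cite: JanssonChaykinKeil2008, §3] [cite: Han2020Bootstrap, §2] -/
theorem TPrimePinnedPairFamilyRowWN.of_chainKernelCerts_tb
    (U : ℚ) (hU : 0 ≤ U) (n₀ sA sB : ℚ)
    {Λ : Finset (Site 2)} (hΛ : Λ ⊆ Literature.Probability.LatticeModels.box 2 7) (h8 : thicken Λ 1 ⊆ Literature.Probability.LatticeModels.box 2 7)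
    (h0 : thicken ({0} : Finset (Site 2)) 1 ⊆ Literature.Probability.LatticeModels.box 2 7) (hz : (0 : Site 2) ∈ Literature.Probability.LatticeModels.box 2 7)
    -- letters (shared): hubbard-obs-p2's chain alphabet `Orb (Fin N)`
    (d : Orb (Fin N) → Orb (PolySite (Literature.Probability.LatticeModels.box 2 7))) (hd : Function.Injective d) (Bkey : ℕ)
    (dΛ : β → Orb (PolySite Λ)) (f : β → Orb (Fin N)) (hf : ∀ b, d (f b) = Orb.embMap (PolySite.incl hΛ) (dΛ b))
    (sp : Orb (Fin N) → Fin 2) (hsp : ∀ a, (ofLex (d a)).2 = sp a)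
    (o : Fin 2 → Orb (Fin N)) (ho : ∀ σ, d (o σ) = orb (PolySite.pt 0 hz) σ)
    (X : ℝ → FermionOp (Literature.Probability.LatticeModels.box 2 7)) (EB : List (Terms β))
    -- vertex A
    (THA : Terms (Orb (Fin N)))
    (hHA : termOp d THA = (hubbardTTPrimeFermionInteraction 1 (sA : ℝ) (U : ℝ)).localHamiltonian (Literature.Probability.LatticeModels.box 2 7))
    (TEA : Terms (Orb (Fin N)))
    (hEA : termOp d TEA = fermionEmbed (PolySite.incl h0) ((hubbardTTPrimeFermionInteraction 1 (sA : ℝ) (U : ℝ)).meanEnergyObs 1))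
    (TXA : Terms (Orb (Fin N))) (hXA : termOp d TXA = X (sA : ℝ)) (μA : Fin 2 → ℚ) (νA κA capA κA' flA : ℚ)
    (KA : ℕ) (blocksA : List (List (List ℤ × Terms (Orb (Fin N)))))
    {nSA : ℕ} (γA : Fin nSA → DihedralGroup 4) (wvA : Fin nSA → Site 2) (hshA : ∀ l, d4ShiftSet (γA l) (wvA l) Λ ⊆ Literature.Probability.LatticeModels.box 2 7)
    (gA : Fin nSA → β → Orb (Fin N))
    (hgA : ∀ l b, d (gA l b) = Orb.embMap (PolySite.incl (hshA l)) (Orb.embMap (PolySite.d4Emb (γA l) (wvA l) Λ) (dΛ b)))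
    (SYA : Fin nSA → Terms β) (CWA : Terms (Orb (Fin N))) (hcwA : ∀ wc ∈ CWA, chargeW wc.1 ≠ 0 ∨ spinChargeW sp wc.1 ≠ 0)
    (AVA : List (Terms (Orb (Fin N))))
    (nsA : List ℕ) (MA : ℕ) (CsA : List SOSDual.EncPoly) (hC0A : CsA.getD 0 [] = [])
    (hchainA : ChainOK Bkey MA CsA
      (groupSlices (residTGslices TXA μA νA o κA capA κA' flA TEA (gramTBslices KA blocksA) THA f EB gA SYA CWA AVA) nsA))
    {βA : ℚ} (hβA : βA ≤ lowerConst (SOSDual.decPoly N (CsA.getD MA [])) + (μA 0 + μA 1) * (n₀ / 2 - νA))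
    {slA : ℚ} (hslA : slA = (μA 0 + μA 1) / 2)
    -- vertex B
    (THB : Terms (Orb (Fin N)))
    (hHB : termOp d THB = (hubbardTTPrimeFermionInteraction 1 (sB : ℝ) (U : ℝ)).localHamiltonian (Literature.Probability.LatticeModels.box 2 7))
    (TEB : Terms (Orb (Fin N)))
    (hEB : termOp d TEB = fermionEmbed (PolySite.incl h0) ((hubbardTTPrimeFermionInteraction 1 (sB : ℝ) (U : ℝ)).meanEnergyObs 1))
    (TXB : Terms (Orb (Fin N))) (hXB : termOp d TXB = X (sB : ℝ)) (μB : Fin 2 → ℚ) (νB κB capB κB' flB : ℚ)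
    (KB : ℕ) (blocksB : List (List (List ℤ × Terms (Orb (Fin N)))))
    {nSB : ℕ} (γB : Fin nSB → DihedralGroup 4) (wvB : Fin nSB → Site 2) (hshB : ∀ l, d4ShiftSet (γB l) (wvB l) Λ ⊆ Literature.Probability.LatticeModels.box 2 7)
    (gB : Fin nSB → β → Orb (Fin N))
    (hgB : ∀ l b, d (gB l b) = Orb.embMap (PolySite.incl (hshB l)) (Orb.embMap (PolySite.d4Emb (γB l) (wvB l) Λ) (dΛ b)))
    (SYB : Fin nSB → Terms β) (CWB : Terms (Orb (Fin N))) (hcwB : ∀ wc ∈ CWB, chargeW wc.1 ≠ 0 ∨ spinChargeW sp wc.1 ≠ 0)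
    (AVB : List (Terms (Orb (Fin N))))
    (nsB : List ℕ) (MB : ℕ) (CsB : List SOSDual.EncPoly) (hC0B : CsB.getD 0 [] = [])
    (hchainB : ChainOK Bkey MB CsB
      (groupSlices (residTGslices TXB μB νB o κB capB κB' flB TEB (gramTBslices KB blocksB) THB f EB gB SYB CWB AVB) nsB))
    {βB : ℚ} (hβB : βB ≤ lowerConst (SOSDual.decPoly N (CsB.getD MB [])) + (μB 0 + μB 1) * (n₀ / 2 - νB))
    {slB : ℚ} (hslB : slB = (μB 0 + μB 1) / 2) :
    TPrimePinnedPairFamilyRowWN (U : ℝ) (sA : ℝ) (sB : ℝ) capA capB flA flB βA κA κA' slA βB κB κB' slB n₀ X := by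
  -- the two SEMANTIC residual facts from the chains (empty start ⇒ last accumulator denotes the whole residual; list identities for the slicing)
  have hRA : evalPoly d (SOSDual.decPoly N (CsA.getD MA [])) =
      termOp d (residTG TXA μA νA o κA capA κA' flA TEA (gramTB KA blocksA) THA f EB gA SYA CWA AVA) := by
    rw [evalPoly_chain_nil hd hC0A hchainA, flatten_groupSlices, flatten_residTGslices, flatten_gramTBslices]
  have hRB : evalPoly d (SOSDual.decPoly N (CsB.getD MB [])) =
      termOp d (residTG TXB μB νB o κB capB κB' flB TEB (gramTB KB blocksB) THB f EB gB SYB CWB AVB) := by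
    rw [evalPoly_chain_nil hd hC0B hchainB, flatten_groupSlices, flatten_residTGslices, flatten_gramTBslices]
  exact TPrimePinnedPairFamilyRowWN.of_residPolys_tb U hU n₀ sA sB hΛ h8 h0 hz d dΛ f hf sp hsp o ho X EB
    THA hHA TEA hEA TXA hXA μA νA κA capA κA' flA KA blocksA γA wvA hshA gA hgA SYA CWA hcwA AVA hRA hβA hslA
    THB hHB TEB hEB TXB hXB μB νB κB capB κB' flB KB blocksB γB wvB hshB gB hgB SYB CWB hcwB AVB hRB hβB hslB

/-- **CONSTANT-OBJECTIVE WN PAIR NODE‴ FROM TWO STAGED KERNEL REPLAYS** (`TPrimePinnedPairRowWN … X₀`), via `TPrimePinnedPairRowWN_iff_family`.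
[cite: WangEtAl2024, §III] [cite: JanssonChaykinKeil2008, §3] -/
theorem TPrimePinnedPairRowWN.of_chainKernelCerts_tb
    (U : ℚ) (hU : 0 ≤ U) (n₀ sA sB : ℚ)
    {Λ : Finset (Site 2)} (hΛ : Λ ⊆ Literature.Probability.LatticeModels.box 2 7) (h8 : thicken Λ 1 ⊆ Literature.Probability.LatticeModels.box 2 7)
    (h0 : thicken ({0} : Finset (Site 2)) 1 ⊆ Literature.Probability.LatticeModels.box 2 7) (hz : (0 : Site 2) ∈ Literature.Probability.LatticeModels.box 2 7)
    (d : Orb (Fin N) → Orb (PolySite (Literature.Probability.LatticeModels.box 2 7))) (hd : Function.Injective d) (Bkey : ℕ)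
    (dΛ : β → Orb (PolySite Λ)) (f : β → Orb (Fin N)) (hf : ∀ b, d (f b) = Orb.embMap (PolySite.incl hΛ) (dΛ b))
    (sp : Orb (Fin N) → Fin 2) (hsp : ∀ a, (ofLex (d a)).2 = sp a)
    (o : Fin 2 → Orb (Fin N)) (ho : ∀ σ, d (o σ) = orb (PolySite.pt 0 hz) σ)
    (X₀ : FermionOp (Literature.Probability.LatticeModels.box 2 7)) (EB : List (Terms β))
    -- vertex A
    (THA : Terms (Orb (Fin N)))
    (hHA : termOp d THA = (hubbardTTPrimeFermionInteraction 1 (sA : ℝ) (U : ℝ)).localHamiltonian (Literature.Probability.LatticeModels.box 2 7))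
    (TEA : Terms (Orb (Fin N)))
    (hEA : termOp d TEA = fermionEmbed (PolySite.incl h0) ((hubbardTTPrimeFermionInteraction 1 (sA : ℝ) (U : ℝ)).meanEnergyObs 1))
    (TXA : Terms (Orb (Fin N))) (hXA : termOp d TXA = X₀) (μA : Fin 2 → ℚ) (νA κA capA κA' flA : ℚ)
    (KA : ℕ) (blocksA : List (List (List ℤ × Terms (Orb (Fin N)))))
    {nSA : ℕ} (γA : Fin nSA → DihedralGroup 4) (wvA : Fin nSA → Site 2) (hshA : ∀ l, d4ShiftSet (γA l) (wvA l) Λ ⊆ Literature.Probability.LatticeModels.box 2 7)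
    (gA : Fin nSA → β → Orb (Fin N))
    (hgA : ∀ l b, d (gA l b) = Orb.embMap (PolySite.incl (hshA l)) (Orb.embMap (PolySite.d4Emb (γA l) (wvA l) Λ) (dΛ b)))
    (SYA : Fin nSA → Terms β) (CWA : Terms (Orb (Fin N))) (hcwA : ∀ wc ∈ CWA, chargeW wc.1 ≠ 0 ∨ spinChargeW sp wc.1 ≠ 0)
    (AVA : List (Terms (Orb (Fin N))))
    (nsA : List ℕ) (MA : ℕ) (CsA : List SOSDual.EncPoly) (hC0A : CsA.getD 0 [] = [])
    (hchainA : ChainOK Bkey MA CsA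
      (groupSlices (residTGslices TXA μA νA o κA capA κA' flA TEA (gramTBslices KA blocksA) THA f EB gA SYA CWA AVA) nsA))
    {βA : ℚ} (hβA : βA ≤ lowerConst (SOSDual.decPoly N (CsA.getD MA [])) + (μA 0 + μA 1) * (n₀ / 2 - νA))
    {slA : ℚ} (hslA : slA = (μA 0 + μA 1) / 2)
    -- vertex B
    (THB : Terms (Orb (Fin N)))
    (hHB : termOp d THB = (hubbardTTPrimeFermionInteraction 1 (sB : ℝ) (U : ℝ)).localHamiltonian (Literature.Probability.LatticeModels.box 2 7))
    (TEB : Terms (Orb (Fin N)))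
    (hEB : termOp d TEB = fermionEmbed (PolySite.incl h0) ((hubbardTTPrimeFermionInteraction 1 (sB : ℝ) (U : ℝ)).meanEnergyObs 1))
    (TXB : Terms (Orb (Fin N))) (hXB : termOp d TXB = X₀) (μB : Fin 2 → ℚ) (νB κB capB κB' flB : ℚ)
    (KB : ℕ) (blocksB : List (List (List ℤ × Terms (Orb (Fin N)))))
    {nSB : ℕ} (γB : Fin nSB → DihedralGroup 4) (wvB : Fin nSB → Site 2) (hshB : ∀ l, d4ShiftSet (γB l) (wvB l) Λ ⊆ Literature.Probability.LatticeModels.box 2 7)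
    (gB : Fin nSB → β → Orb (Fin N))
    (hgB : ∀ l b, d (gB l b) = Orb.embMap (PolySite.incl (hshB l)) (Orb.embMap (PolySite.d4Emb (γB l) (wvB l) Λ) (dΛ b)))
    (SYB : Fin nSB → Terms β) (CWB : Terms (Orb (Fin N))) (hcwB : ∀ wc ∈ CWB, chargeW wc.1 ≠ 0 ∨ spinChargeW sp wc.1 ≠ 0)
    (AVB : List (Terms (Orb (Fin N))))
    (nsB : List ℕ) (MB : ℕ) (CsB : List SOSDual.EncPoly) (hC0B : CsB.getD 0 [] = [])
    (hchainB : ChainOK Bkey MB CsB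
      (groupSlices (residTGslices TXB μB νB o κB capB κB' flB TEB (gramTBslices KB blocksB) THB f EB gB SYB CWB AVB) nsB))
    {βB : ℚ} (hβB : βB ≤ lowerConst (SOSDual.decPoly N (CsB.getD MB [])) + (μB 0 + μB 1) * (n₀ / 2 - νB))
    {slB : ℚ} (hslB : slB = (μB 0 + μB 1) / 2) :
    TPrimePinnedPairRowWN (U : ℝ) (sA : ℝ) (sB : ℝ) capA capB flA flB βA κA κA' slA βB κB κB' slB n₀ X₀ :=
  (TPrimePinnedPairRowWN_iff_family).2
    (TPrimePinnedPairFamilyRowWN.of_chainKernelCerts_tb U hU n₀ sA sB hΛ h8 h0 hz d hd Bkey dΛ f hf sp hsp o ho (fun _ => X₀) EB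
      THA hHA TEA hEA TXA hXA μA νA κA capA κA' flA KA blocksA γA wvA hshA gA hgA SYA CWA hcwA AVA nsA MA CsA hC0A hchainA hβA hslA
      THB hHB TEB hEB TXB hXB μB νB κB capB κB' flB KB blocksB γB wvB hshB gB hgB SYB CWB hcwB AVB nsB MB CsB hC0B hchainB hβB hslB)

end ChainPair

/-! ## §2 The M2(c) leaf from four chains (two chain pairs) + decidable row data -/

section ChainCloser

variable {β : Type*} {N : ℕ} [NeZero N]

/-- **`La214M2c_StiffnessBoxCeiling` ⇐ TWO CHAIN PAIRS (`Po`, `Oi`) + DECIDABLE ROW DATA** — FILE D's binder list with, per vertex, hubbard-obs-p2's chain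
data (two-level Gram `blocks_v`, slice groups `ns_v`, step count `M_v`, accumulators `Cs_v`, `Cs_v.getD 0 [] = []`, `ChainOK …`, ONE inequality on the last
accumulator) in place of the one-shot normal form; via `…of_chainKernelCerts_tb` ×2 and `La214M2c_StiffnessBoxCeiling_of_pairRows`. [cite: WangEtAl2024, §III]
[cite: JanssonChaykinKeil2008, §3] [cite: KomaTasaki1994, §1] -/
theorem La214M2c_StiffnessBoxCeiling_of_chainKernelPairs
    {Λ : Finset (Site 2)} (hΛ : Λ ⊆ Literature.Probability.LatticeModels.box 2 7) (h8 : thicken Λ 1 ⊆ Literature.Probability.LatticeModels.box 2 7)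
    (h0 : thicken ({0} : Finset (Site 2)) 1 ⊆ Literature.Probability.LatticeModels.box 2 7) (hz : (0 : Site 2) ∈ Literature.Probability.LatticeModels.box 2 7)
    -- letters (shared)
    (d : Orb (Fin N) → Orb (PolySite (Literature.Probability.LatticeModels.box 2 7))) (hd : Function.Injective d) (Bkey : ℕ)
    (dΛ : β → Orb (PolySite Λ)) (f : β → Orb (Fin N)) (hf : ∀ b, d (f b) = Orb.embMap (PolySite.incl hΛ) (dΛ b))
    (sp : Orb (Fin N) → Fin 2) (hsp : ∀ a, (ofLex (d a)).2 = sp a)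
    (o : Fin 2 → Orb (Fin N)) (ho : ∀ σ, d (o σ) = orb (PolySite.pt 0 hz) σ)
    -- the `Po` pair: ONE shared eom word list
    (EBo : List (Terms β))
    -- vertex oA (t′ = (-(357 / 740) : ℚ))
    (THoA : Terms (Orb (Fin N)))
    (hHoA : termOp d THoA = (hubbardTTPrimeFermionInteraction 1 (((-(357 / 740) : ℚ)) : ℝ) (((29 / 5 : ℚ)) : ℝ)).localHamiltonian (Literature.Probability.LatticeModels.box 2 7))
    (TEoA : Terms (Orb (Fin N)))
    (hEoA : termOp d TEoA =
      fermionEmbed (PolySite.incl h0) ((hubbardTTPrimeFermionInteraction 1 (((-(357 / 740) : ℚ)) : ℝ) (((29 / 5 : ℚ)) : ℝ)).meanEnergyObs 1))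
    (TXoA : Terms (Orb (Fin N))) (hXoA : termOp d TXoA = -oddMomentObsTT (-3 / 10) (29 / 5) 0)
    (μoA : Fin 2 → ℚ) (νoA κoA capoA κoA' floA : ℚ) (KoA : ℕ) (blocksoA : List (List (List ℤ × Terms (Orb (Fin N)))))
    {nSoA : ℕ} (γoA : Fin nSoA → DihedralGroup 4) (wvoA : Fin nSoA → Site 2)
    (hshoA : ∀ l, d4ShiftSet (γoA l) (wvoA l) Λ ⊆ Literature.Probability.LatticeModels.box 2 7) (goA : Fin nSoA → β → Orb (Fin N))
    (hgoA : ∀ l b, d (goA l b) = Orb.embMap (PolySite.incl (hshoA l)) (Orb.embMap (PolySite.d4Emb (γoA l) (wvoA l) Λ) (dΛ b)))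
    (SYoA : Fin nSoA → Terms β) (CWoA : Terms (Orb (Fin N))) (hcwoA : ∀ wc ∈ CWoA, chargeW wc.1 ≠ 0 ∨ spinChargeW sp wc.1 ≠ 0)
    (AVoA : List (Terms (Orb (Fin N))))
    (nsoA : List ℕ) (MoA : ℕ) (CsoA : List SOSDual.EncPoly) (hC0oA : CsoA.getD 0 [] = [])
    (hchainoA : ChainOK Bkey MoA CsoA
      (groupSlices (residTGslices TXoA μoA νoA o κoA capoA κoA' floA TEoA (gramTBslices KoA blocksoA) THoA f EBo goA SYoA CWoA AVoA) nsoA))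
    {βoA : ℚ} (hβoA : βoA ≤ lowerConst (SOSDual.decPoly N (CsoA.getD MoA [])) + (μoA 0 + μoA 1) * ((7 / 8 : ℚ) / 2 - νoA))
    {sloA : ℚ} (hsloA : sloA = (μoA 0 + μoA 1) / 2)
    -- vertex oB (t′ = (-3 / 10 : ℚ))
    (THoB : Terms (Orb (Fin N)))
    (hHoB : termOp d THoB = (hubbardTTPrimeFermionInteraction 1 (((-3 / 10 : ℚ)) : ℝ) (((29 / 5 : ℚ)) : ℝ)).localHamiltonian (Literature.Probability.LatticeModels.box 2 7))
    (TEoB : Terms (Orb (Fin N)))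
    (hEoB : termOp d TEoB =
      fermionEmbed (PolySite.incl h0) ((hubbardTTPrimeFermionInteraction 1 (((-3 / 10 : ℚ)) : ℝ) (((29 / 5 : ℚ)) : ℝ)).meanEnergyObs 1))
    (TXoB : Terms (Orb (Fin N))) (hXoB : termOp d TXoB = -oddMomentObsTT (-3 / 10) (29 / 5) 0)
    (μoB : Fin 2 → ℚ) (νoB κoB capoB κoB' floB : ℚ) (KoB : ℕ) (blocksoB : List (List (List ℤ × Terms (Orb (Fin N)))))
    {nSoB : ℕ} (γoB : Fin nSoB → DihedralGroup 4) (wvoB : Fin nSoB → Site 2)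
    (hshoB : ∀ l, d4ShiftSet (γoB l) (wvoB l) Λ ⊆ Literature.Probability.LatticeModels.box 2 7) (goB : Fin nSoB → β → Orb (Fin N))
    (hgoB : ∀ l b, d (goB l b) = Orb.embMap (PolySite.incl (hshoB l)) (Orb.embMap (PolySite.d4Emb (γoB l) (wvoB l) Λ) (dΛ b)))
    (SYoB : Fin nSoB → Terms β) (CWoB : Terms (Orb (Fin N))) (hcwoB : ∀ wc ∈ CWoB, chargeW wc.1 ≠ 0 ∨ spinChargeW sp wc.1 ≠ 0)
    (AVoB : List (Terms (Orb (Fin N))))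
    (nsoB : List ℕ) (MoB : ℕ) (CsoB : List SOSDual.EncPoly) (hC0oB : CsoB.getD 0 [] = [])
    (hchainoB : ChainOK Bkey MoB CsoB
      (groupSlices (residTGslices TXoB μoB νoB o κoB capoB κoB' floB TEoB (gramTBslices KoB blocksoB) THoB f EBo goB SYoB CWoB AVoB) nsoB))
    {βoB : ℚ} (hβoB : βoB ≤ lowerConst (SOSDual.decPoly N (CsoB.getD MoB [])) + (μoB 0 + μoB 1) * ((7 / 8 : ℚ) / 2 - νoB))
    {sloB : ℚ} (hsloB : sloB = (μoB 0 + μoB 1) / 2)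
    -- the `Oi` pair: ONE shared eom word list
    (EBi : List (Terms β))
    -- vertex iA (t′ = (-3 / 10 : ℚ))
    (THiA : Terms (Orb (Fin N)))
    (hHiA : termOp d THiA = (hubbardTTPrimeFermionInteraction 1 (((-3 / 10 : ℚ)) : ℝ) (((29 / 5 : ℚ)) : ℝ)).localHamiltonian (Literature.Probability.LatticeModels.box 2 7))
    (TEiA : Terms (Orb (Fin N)))
    (hEiA : termOp d TEiA =
      fermionEmbed (PolySite.incl h0) ((hubbardTTPrimeFermionInteraction 1 (((-3 / 10 : ℚ)) : ℝ) (((29 / 5 : ℚ)) : ℝ)).meanEnergyObs 1))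
    (TXiA : Terms (Orb (Fin N))) (hXiA : termOp d TXiA = -oddMomentObsTT (-3 / 10) (29 / 5) 0)
    (μiA : Fin 2 → ℚ) (νiA κiA capiA κiA' fliA : ℚ) (KiA : ℕ) (blocksiA : List (List (List ℤ × Terms (Orb (Fin N)))))
    {nSiA : ℕ} (γiA : Fin nSiA → DihedralGroup 4) (wviA : Fin nSiA → Site 2)
    (hshiA : ∀ l, d4ShiftSet (γiA l) (wviA l) Λ ⊆ Literature.Probability.LatticeModels.box 2 7) (giA : Fin nSiA → β → Orb (Fin N))
    (hgiA : ∀ l b, d (giA l b) = Orb.embMap (PolySite.incl (hshiA l)) (Orb.embMap (PolySite.d4Emb (γiA l) (wviA l) Λ) (dΛ b)))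
    (SYiA : Fin nSiA → Terms β) (CWiA : Terms (Orb (Fin N))) (hcwiA : ∀ wc ∈ CWiA, chargeW wc.1 ≠ 0 ∨ spinChargeW sp wc.1 ≠ 0)
    (AViA : List (Terms (Orb (Fin N))))
    (nsiA : List ℕ) (MiA : ℕ) (CsiA : List SOSDual.EncPoly) (hC0iA : CsiA.getD 0 [] = [])
    (hchainiA : ChainOK Bkey MiA CsiA
      (groupSlices (residTGslices TXiA μiA νiA o κiA capiA κiA' fliA TEiA (gramTBslices KiA blocksiA) THiA f EBi giA SYiA CWiA AViA) nsiA))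
    {βiA : ℚ} (hβiA : βiA ≤ lowerConst (SOSDual.decPoly N (CsiA.getD MiA [])) + (μiA 0 + μiA 1) * ((7 / 8 : ℚ) / 2 - νiA))
    {sliA : ℚ} (hsliA : sliA = (μiA 0 + μiA 1) / 2)
    -- vertex iB (t′ = (-1 / 5 : ℚ))
    (THiB : Terms (Orb (Fin N)))
    (hHiB : termOp d THiB = (hubbardTTPrimeFermionInteraction 1 (((-1 / 5 : ℚ)) : ℝ) (((29 / 5 : ℚ)) : ℝ)).localHamiltonian (Literature.Probability.LatticeModels.box 2 7))
    (TEiB : Terms (Orb (Fin N)))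
    (hEiB : termOp d TEiB =
      fermionEmbed (PolySite.incl h0) ((hubbardTTPrimeFermionInteraction 1 (((-1 / 5 : ℚ)) : ℝ) (((29 / 5 : ℚ)) : ℝ)).meanEnergyObs 1))
    (TXiB : Terms (Orb (Fin N))) (hXiB : termOp d TXiB = -oddMomentObsTT (-1 / 5) (29 / 5) 0)
    (μiB : Fin 2 → ℚ) (νiB κiB capiB κiB' fliB : ℚ) (KiB : ℕ) (blocksiB : List (List (List ℤ × Terms (Orb (Fin N)))))
    {nSiB : ℕ} (γiB : Fin nSiB → DihedralGroup 4) (wviB : Fin nSiB → Site 2)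
    (hshiB : ∀ l, d4ShiftSet (γiB l) (wviB l) Λ ⊆ Literature.Probability.LatticeModels.box 2 7) (giB : Fin nSiB → β → Orb (Fin N))
    (hgiB : ∀ l b, d (giB l b) = Orb.embMap (PolySite.incl (hshiB l)) (Orb.embMap (PolySite.d4Emb (γiB l) (wviB l) Λ) (dΛ b)))
    (SYiB : Fin nSiB → Terms β) (CWiB : Terms (Orb (Fin N))) (hcwiB : ∀ wc ∈ CWiB, chargeW wc.1 ≠ 0 ∨ spinChargeW sp wc.1 ≠ 0)
    (AViB : List (Terms (Orb (Fin N))))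
    (nsiB : List ℕ) (MiB : ℕ) (CsiB : List SOSDual.EncPoly) (hC0iB : CsiB.getD 0 [] = [])
    (hchainiB : ChainOK Bkey MiB CsiB
      (groupSlices (residTGslices TXiB μiB νiB o κiB capiB κiB' fliB TEiB (gramTBslices KiB blocksiB) THiB f EBi giB SYiB CWiB AViB) nsiB))
    {βiB : ℚ} (hβiB : βiB ≤ lowerConst (SOSDual.decPoly N (CsiB.getD MiB [])) + (μiB 0 + μiB 1) * ((7 / 8 : ℚ) / 2 - νiB))
    {sliB : ℚ} (hsliB : sliB = (μiB 0 + μiB 1) / 2)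
    -- row data and DECIDABLE side conditions
    (Fo Lo Fi Li c : ℚ)
    (hκoA : 0 ≤ κoA) (hκoA' : 0 ≤ κoA') (hκoB : 0 ≤ κoB) (hκoB' : 0 ≤ κoB')
    (hκiA : 0 ≤ κiA) (hκiA' : 0 ≤ κiA') (hκiB : 0 ≤ κiB) (hκiB' : 0 ≤ κiB')
    (hLo₁ : (16211390 / 10000000 : ℚ) * (27 / 148) * (κoA - κoA' - (κoB - κoB')) ≤ Lo)
    (hLo₂ : (16211390 / 10000000 : ℚ) * (27 / 148) * -(κoA - κoA' - (κoB - κoB')) ≤ Lo) (hLo0 : 0 < Lo)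
    (hFo : Fo ≤ (βoA - κoA * ((-136960406889 / 200000000000 : ℚ) - capoA) - κoA' * (floA - (-3))) -
      (Lo - ((βoB - κoB * ((-136960406889 / 200000000000 : ℚ) - capoB) - κoB' * (floB - (-3))) - (βoA - κoA * ((-136960406889 / 200000000000 : ℚ) - capoA) - κoA' * (floA - (-3))))) ^ 2 / (4 * Lo))
    (hLi₁ : (16211390 / 10000000 : ℚ) * (1 / 10) * (κiA - κiA' - (κiB - κiB')) ≤ Li)
    (hLi₂ : (16211390 / 10000000 : ℚ) * (1 / 10) * -(κiA - κiA' - (κiB - κiB')) ≤ Li) (hLi0 : 0 ≤ Li)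
    (hLi : Li ≤ |(βiB - κiB * ((-2686934003 / 4000000000 : ℚ) - capiB) - κiB' * (fliB - (-3))) - (βiA - κiA * ((-2686934003 / 4000000000 : ℚ) - capiA) - κiA' * (fliA - (-3)))|)
    (hFi : Fi ≤ min (βiA - κiA * ((-2686934003 / 4000000000 : ℚ) - capiA) - κiA' * (fliA - (-3))) (βiB - κiB * ((-2686934003 / 4000000000 : ℚ) - capiB) - κiB' * (fliB - (-3))))
    (hbar : c ≤ 4017332 / 10000000) (hkin : (4001658052 / 10000000000 : ℚ) ≤ c)
    (pPo : -Fo - sloA * (171 / 200 - 7 / 8) ≤ c ∧ -Fo - sloA * (179 / 200 - 7 / 8) ≤ c ∧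
      -Fo - sloB * (171 / 200 - 7 / 8) ≤ c ∧ -Fo - sloB * (179 / 200 - 7 / 8) ≤ c)
    (pOi : -Fi - sliA * (171 / 200 - 7 / 8) ≤ c ∧ -Fi - sliA * (179 / 200 - 7 / 8) ≤ c ∧
      -Fi - sliB * (171 / 200 - 7 / 8) ≤ c ∧ -Fi - sliB * (179 / 200 - 7 / 8) ≤ c) :
    La214M2c_StiffnessBoxCeiling := by
  -- cast literals
  have eU : (((29 / 5 : ℚ)) : ℝ) = 29 / 5 := by norm_num
  have eo : (((-(357 / 740) : ℚ)) : ℝ) = -(357 / 740) := by norm_num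
  have em : (((-3 / 10 : ℚ)) : ℝ) = -3 / 10 := by norm_num
  have ei : (((-1 / 5 : ℚ)) : ℝ) = -1 / 5 := by norm_num
  -- (1) the `Po` chain pair ⇒ the constant-objective pair row
  have pairPo := TPrimePinnedPairRowWN.of_chainKernelCerts_tb (29 / 5) (by norm_num) (7 / 8) (-(357 / 740)) (-3 / 10) hΛ h8 h0 hz d hd Bkey dΛ f hf sp hsp o ho
    (-oddMomentObsTT (-3 / 10) (29 / 5) 0) EBo
    THoA hHoA TEoA hEoA TXoA hXoA μoA νoA κoA capoA κoA' floA KoA blocksoA γoA wvoA hshoA goA hgoA SYoA CWoA hcwoA AVoA nsoA MoA CsoA hC0oA hchainoA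
    hβoA hsloA
    THoB hHoB TEoB hEoB TXoB hXoB μoB νoB κoB capoB κoB' floB KoB blocksoB γoB wvoB hshoB goB hgoB SYoB CWoB hcwoB AVoB nsoB MoB CsoB hC0oB hchainoB
    hβoB hsloB
  rw [eU, eo, em] at pairPo
  -- (2) the `Oi` chain pair ⇒ the objective-family pair row
  have hXiA' : termOp d TXiA = (fun s : ℝ => -oddMomentObsTT s (29 / 5) 0) (((-3 / 10 : ℚ)) : ℝ) := by
    simp only [em]; exact hXiA
  have hXiB' : termOp d TXiB = (fun s : ℝ => -oddMomentObsTT s (29 / 5) 0) (((-1 / 5 : ℚ)) : ℝ) := by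
    simp only [ei]; exact hXiB
  have pairOi := TPrimePinnedPairFamilyRowWN.of_chainKernelCerts_tb (29 / 5) (by norm_num) (7 / 8) (-3 / 10) (-1 / 5) hΛ h8 h0 hz d hd Bkey dΛ f hf sp hsp o ho
    (fun s : ℝ => -oddMomentObsTT s (29 / 5) 0) EBi
    THiA hHiA TEiA hEiA TXiA hXiA' μiA νiA κiA capiA κiA' fliA KiA blocksiA γiA wviA hshiA giA hgiA SYiA CWiA hcwiA AViA nsiA MiA CsiA hC0iA hchainiA
    hβiA hsliA
    THiB hHiB TEiB hEiB TXiB hXiB' μiB νiB κiB capiB κiB' fliB KiB blocksiB γiB wviB hshiB giB hgiB SYiB CWiB hcwiB AViB nsiB MiB CsiB hC0iB hchainiB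
    hβiB hsliB
  rw [eU, em, ei] at pairOi
  -- (3) the shape-level closer
  exact La214M2c_StiffnessBoxCeiling_of_pairRows pairPo pairOi Fo Lo Fi Li c hκoA hκoA' hκoB hκoB' hκiA hκiA' hκiB hκiB' hLo₁ hLo₂ hLo0 hFo
    hLi₁ hLi₂ hLi0 hLi hFi hbar hkin pPo pOi

end ChainCloser

end Summit.Ventures.CertifiedManyBodySolver.Downfold

end
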